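import Literature.NumberTheory.Weil1965.AdelicFibreMeasures
import Literature.NumberTheory.Weil1964.AdelicSchrodingerConj
import HarnessLib

/-!
# Weil's `E_X` on COMPLEX Schwartz–Bruhat functions: `Σ_ξ F*_Φ(ξ) = E_X(Re Φ) + i E_X(Im Φ)`

Topic `NumberTheory/Weil1965`; namespace `Literature.NumberTheory.Weil1965` (sequel of `AdelicFibreMeasures`).
KERNEL MATHEMATICS ONLY: proved theorems, no definition, no named fact, no `sorry`.

`AdelicFibreMeasures` realises Weil's functional `E_X(Φ) = Σ_{ξ ∈ F} F*_Φ(ξ)` [Weil1965, Chap. IV n° 41 (34)] on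
the REAL Schwartz–Bruhat functions (`adelicSiegelFunctional`, real part of the series) so as to obtain a positive
Radon measure. Consumers (the Siegel–Eisenstein unfolding, the Siegel–Weil comparison) evaluate the series on complex
`Φ ∈ 𝒮(X) = piSchwartzBruhat F ι`. This file supplies the glue:

* §1 `re_mem_piSchwartzBruhatReal`, `im_mem_piSchwartzBruhatReal` — real and imaginary parts of a complex
  Schwartz–Bruhat function are real Schwartz–Bruhat functions (`𝒮(X)` is stable under complex conjugation,
  ★ `star_mem_piSchwartzBruhat`);
* §2 `conj_adelicSiegelCoeff_ofReal`, `im_tsum_adelicSiegelCoeff_ofReal_eq_zero`, `ofReal_adelicSiegelFunctional` —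
  for a REAL `Ψ` the coefficients satisfy `conj F*_Ψ(ξ) = F*_Ψ(−ξ)`, so `Σ_ξ F*_Ψ(ξ)` is real and equals
  `E_X(Ψ)` (as a complex number);
* §3 `tsum_adelicSiegelCoeff_eq_re_add_im` — for `Φ ∈ 𝒮(X)`:
  `Σ_ξ F*_Φ(ξ) = E_X(Re Φ) + i · E_X(Im Φ)`.

## References

* A. Weil, *Sur la formule de Siegel dans la théorie des groupes classiques*, Acta Math. 113 (1965): Chap. IV n° 41,
  (34)–(35), pp. 58–59 [Weil1965].
-/

noncomputable section

open MeasureTheory NumberField IsDedekindDomain Filter Topology Set Literature.NumberTheory.Automorphic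
  Literature.NumberTheory.Weil1964
open scoped Classical ComplexConjugate

namespace Literature.NumberTheory.Weil1965

variable (F : Type) [Field F] [NumberField F] (ι : Type) [Fintype ι]

/-! ### §1 Real and imaginary parts of Schwartz–Bruhat functions -/

variable {F ι} in
/-- **The real part of a Schwartz–Bruhat function is a real Schwartz–Bruhat function**
(`Re Φ = (Φ + Φ̄)/2`, ★ `star_mem_piSchwartzBruhat`). [cite: Weil1965, Chap. IV n° 41, p. 59] -/
theorem re_mem_piSchwartzBruhatReal {Φ : (ι → AdeleRing (𝓞 F) F) → ℂ} (hΦ : Φ ∈ piSchwartzBruhat F ι) :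
    (fun v => (Φ v).re) ∈ piSchwartzBruhatReal F ι := by
  rw [mem_piSchwartzBruhatReal_iff]
  have h : ((2 : ℂ)⁻¹) • (Φ + star Φ) ∈ piSchwartzBruhat F ι :=
    Submodule.smul_mem _ _ (add_mem hΦ (star_mem_piSchwartzBruhat hΦ))
  convert h using 1
  funext v
  rw [Complex.re_eq_add_conj, Pi.smul_apply, Pi.add_apply, smul_eq_mul, div_eq_inv_mul]
  rfl

variable {F ι} in
/-- **The imaginary part of a Schwartz–Bruhat function is a real Schwartz–Bruhat function**
(`Im Φ = (Φ − Φ̄)/(2i)`). [cite: Weil1965, Chap. IV n° 41, p. 59] -/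
theorem im_mem_piSchwartzBruhatReal {Φ : (ι → AdeleRing (𝓞 F) F) → ℂ} (hΦ : Φ ∈ piSchwartzBruhat F ι) :
    (fun v => (Φ v).im) ∈ piSchwartzBruhatReal F ι := by
  rw [mem_piSchwartzBruhatReal_iff]
  have h : ((2 * Complex.I : ℂ)⁻¹) • (Φ - star Φ) ∈ piSchwartzBruhat F ι :=
    Submodule.smul_mem _ _ (sub_mem hΦ (star_mem_piSchwartzBruhat hΦ))
  convert h using 1
  funext v
  rw [Complex.im_eq_sub_conj, Pi.smul_apply, Pi.sub_apply, smul_eq_mul, div_eq_inv_mul]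
  rfl

variable {F ι} in
omit [Fintype ι] in
/-- `Φ = Re Φ + i Im Φ` pointwise, as functions. [cite: Weil1965, Chap. IV n° 41, p. 59] -/
theorem fun_eq_re_add_im (Φ : (ι → AdeleRing (𝓞 F) F) → ℂ) :
    Φ = (fun v => ((Φ v).re : ℂ)) + Complex.I • fun v => ((Φ v).im : ℂ) := by
  funext v
  simp only [Pi.add_apply, Pi.smul_apply, smul_eq_mul]
  rw [mul_comm]
  exact (Complex.re_add_im (Φ v)).symm

/-! ### §2 Reality of the series for real functions -/

section Real

variable [MeasurableSpace (adeleQuotient F)] [BorelSpace (adeleQuotient F)]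
  [MeasurableSpace (AdeleRing (𝓞 F) F)] [BorelSpace (AdeleRing (𝓞 F) F)]
  (μ : Measure (ι → AdeleRing (𝓞 F) F)) (h : (ι → AdeleRing (𝓞 F) F) → AdeleRing (𝓞 F) F)

omit [MeasurableSpace (adeleQuotient F)] [BorelSpace (adeleQuotient F)] [BorelSpace (AdeleRing (𝓞 F) F)]
  [Fintype ι] in
/-- **`conj F*_Ψ(ξ) = F*_Ψ(−ξ)` for a real `Ψ`** (`conj ψ(a) = ψ(−a)`).
[cite: Weil1965, Chap. IV n° 41, p. 59] -/
theorem conj_adelicSiegelCoeff_ofReal (Ψ : (ι → AdeleRing (𝓞 F) F) → ℝ) (ξ : F) :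
    conj (adelicSiegelCoeff F ι μ h (fun v => (Ψ v : ℂ)) ξ) =
      adelicSiegelCoeff F ι μ h (fun v => (Ψ v : ℂ)) (-ξ) := by
  simp only [adelicSiegelCoeff, ← integral_conj, map_mul, Complex.conj_ofReal, adeleQuotChar_mk]
  refine integral_congr_ae (ae_of_all _ fun x => ?_)
  dsimp only
  rw [← Circle.coe_inv_eq_conj, ← AddChar.map_neg_eq_inv, map_neg (algebraMap F (AdeleRing (𝓞 F) F)), neg_mul]

omit [MeasurableSpace (adeleQuotient F)] [BorelSpace (adeleQuotient F)] [BorelSpace (AdeleRing (𝓞 F) F)]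
  [Fintype ι] in
/-- **`Σ_ξ F*_Ψ(ξ)` is real for a real `Ψ`** (re-index `ξ ↦ −ξ`).
[cite: Weil1965, Chap. IV n° 41, (34) p. 59] -/
theorem conj_tsum_adelicSiegelCoeff_ofReal (Ψ : (ι → AdeleRing (𝓞 F) F) → ℝ) :
    conj (∑' ξ : F, adelicSiegelCoeff F ι μ h (fun v => (Ψ v : ℂ)) ξ) =
      ∑' ξ : F, adelicSiegelCoeff F ι μ h (fun v => (Ψ v : ℂ)) ξ := by
  rw [Complex.conj_tsum]
  simp only [conj_adelicSiegelCoeff_ofReal]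
  exact (Equiv.neg F).tsum_eq fun ξ => adelicSiegelCoeff F ι μ h (fun v => (Ψ v : ℂ)) ξ

omit [MeasurableSpace (adeleQuotient F)] [BorelSpace (adeleQuotient F)] [BorelSpace (AdeleRing (𝓞 F) F)]
  [Fintype ι] in
/-- The imaginary part of `Σ_ξ F*_Ψ(ξ)` vanishes for a real `Ψ`. [cite: Weil1965, Chap. IV n° 41, (34) p. 59] -/
theorem im_tsum_adelicSiegelCoeff_ofReal_eq_zero (Ψ : (ι → AdeleRing (𝓞 F) F) → ℝ) :
    (∑' ξ : F, adelicSiegelCoeff F ι μ h (fun v => (Ψ v : ℂ)) ξ).im = 0 :=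
  Complex.conj_eq_iff_im.mp (conj_tsum_adelicSiegelCoeff_ofReal F ι μ h Ψ)

variable {μ h}

omit [MeasurableSpace (adeleQuotient F)] [BorelSpace (adeleQuotient F)] in
/-- **`E_X(Ψ) = Σ_ξ F*_Ψ(ξ)` as complex numbers** for `Ψ ∈ 𝒮_ℝ(X)` (the real functional IS the series).
[cite: Weil1965, Chap. IV n° 41, (34) p. 59] -/
theorem ofReal_adelicSiegelFunctional [μ.IsAddHaarMeasure] (hh : Continuous h)
    (hB : ∀ Φ ∈ piSchwartzBruhat F ι, Summable fun ξ : F => ‖adelicSiegelCoeff F ι μ h Φ ξ‖)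
    (Ψ : piSchwartzBruhatReal F ι) :
    ((adelicSiegelFunctional F ι μ h hh hB Ψ : ℝ) : ℂ) =
      ∑' ξ : F, adelicSiegelCoeff F ι μ h (fun v => ((Ψ : (ι → AdeleRing (𝓞 F) F) → ℝ) v : ℂ)) ξ := by
  rw [adelicSiegelFunctional_apply]
  exact Complex.ext (by simp only [Complex.ofReal_re])
    (by rw [Complex.ofReal_im, im_tsum_adelicSiegelCoeff_ofReal_eq_zero])

end Real

/-! ### §3 The series on complex Schwartz–Bruhat functions -/

section Complex

variable [MeasurableSpace (adeleQuotient F)] [BorelSpace (adeleQuotient F)]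
  [MeasurableSpace (AdeleRing (𝓞 F) F)] [BorelSpace (AdeleRing (𝓞 F) F)]
  {μ : Measure (ι → AdeleRing (𝓞 F) F)} [μ.IsAddHaarMeasure]
  {h : (ι → AdeleRing (𝓞 F) F) → AdeleRing (𝓞 F) F} (hh : Continuous h)
  (hB : ∀ Φ ∈ piSchwartzBruhat F ι, Summable fun ξ : F => ‖adelicSiegelCoeff F ι μ h Φ ξ‖)

omit [MeasurableSpace (adeleQuotient F)] [BorelSpace (adeleQuotient F)] in
/-- **`F*_Φ(ξ) = F*_{Re Φ}(ξ) + i F*_{Im Φ}(ξ)`** for `Φ ∈ 𝒮(X)` (linearity of `F*`).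
[cite: Weil1965, Chap. IV n° 41, p. 59] -/
theorem adelicSiegelCoeff_eq_re_add_im (hh : Continuous h) {Φ : (ι → AdeleRing (𝓞 F) F) → ℂ}
    (hΦ : Φ ∈ piSchwartzBruhat F ι) (ξ : F) :
    adelicSiegelCoeff F ι μ h Φ ξ =
      adelicSiegelCoeff F ι μ h (fun v => ((Φ v).re : ℂ)) ξ +
        Complex.I * adelicSiegelCoeff F ι μ h (fun v => ((Φ v).im : ℂ)) ξ := by
  have hre := re_mem_piSchwartzBruhatReal hΦ
  have him := im_mem_piSchwartzBruhatReal hΦ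
  rw [mem_piSchwartzBruhatReal_iff] at hre him
  conv_lhs => rw [fun_eq_re_add_im Φ]
  rw [adelicSiegelCoeff_add hh (integrable_of_mem_piSchwartzBruhat (ν := μ) hre)
    ((integrable_of_mem_piSchwartzBruhat (ν := μ) him).smul Complex.I), adelicSiegelCoeff_smul]

omit [MeasurableSpace (adeleQuotient F)] [BorelSpace (adeleQuotient F)] in
/-- **`Σ_ξ F*_Φ(ξ) = E_X(Re Φ) + i · E_X(Im Φ)` for every `Φ ∈ 𝒮(X)`** — Weil's `E_X(Φ)` on complex test
functions in terms of the positive functional of `AdelicFibreMeasures`.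
[cite: Weil1965, Chap. IV n° 41, (34) p. 59] -/
theorem tsum_adelicSiegelCoeff_eq_re_add_im {Φ : (ι → AdeleRing (𝓞 F) F) → ℂ} (hΦ : Φ ∈ piSchwartzBruhat F ι) :
    ∑' ξ : F, adelicSiegelCoeff F ι μ h Φ ξ =
      (adelicSiegelFunctional F ι μ h hh hB ⟨fun v => (Φ v).re, re_mem_piSchwartzBruhatReal hΦ⟩ : ℂ) +
        Complex.I *
          (adelicSiegelFunctional F ι μ h hh hB ⟨fun v => (Φ v).im, im_mem_piSchwartzBruhatReal hΦ⟩ : ℂ) := by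
  have hre := re_mem_piSchwartzBruhatReal hΦ
  have him := im_mem_piSchwartzBruhatReal hΦ
  rw [mem_piSchwartzBruhatReal_iff] at hre him
  rw [ofReal_adelicSiegelFunctional, ofReal_adelicSiegelFunctional]
  rw [← (hB _ him).of_norm.tsum_mul_left Complex.I, ← (hB _ hre).of_norm.tsum_add
    (((hB _ him).of_norm).mul_left Complex.I)]
  exact tsum_congr fun ξ => adelicSiegelCoeff_eq_re_add_im F ι hh hΦ ξ

omit [MeasurableSpace (adeleQuotient F)] [BorelSpace (adeleQuotient F)] [BorelSpace (AdeleRing (𝓞 F) F)]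
  [μ.IsAddHaarMeasure] in
include hB in
/-- **Summability is inherited by real and imaginary parts** (they lie in `𝒮(X)`): the `hB` binder evaluated at
`Re Φ`, `Im Φ`. [cite: Weil1965, Chap. IV n° 41, p. 59] -/
theorem summable_norm_adelicSiegelCoeff_re_im {Φ : (ι → AdeleRing (𝓞 F) F) → ℂ} (hΦ : Φ ∈ piSchwartzBruhat F ι) :
    (Summable fun ξ : F => ‖adelicSiegelCoeff F ι μ h (fun v => ((Φ v).re : ℂ)) ξ‖) ∧
      Summable fun ξ : F => ‖adelicSiegelCoeff F ι μ h (fun v => ((Φ v).im : ℂ)) ξ‖ :=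
  ⟨hB _ (re_mem_piSchwartzBruhatReal hΦ), hB _ (im_mem_piSchwartzBruhatReal hΦ)⟩

end Complex

end Literature.NumberTheory.Weil1965
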